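import Summits.Ventures.PercRepro0.NewmanTransferBox

/-!
# R_MID-12 · NEWMAN TRANSFER — the truncated box sums, Cauchy–Schwarz and the FTC step (seat p2, part 3/4)

Lean twin of proofs/D7TRANSFER-p2-v1.md §5 (Lemma 5, first half) (cell pub-perc-repro0; lead RULING
H (11)), on the finite-box material of `NewmanCluster.lean` / `NewmanTransferBox.lean`:

* `S d L N p = ∑_{F ∈ animals L, |vert F| ≤ N} w_F(p) = P_p(|C_L(0)| ≤ N)`, a polynomial in `p`
  (`S_eq_P`, `hasDerivAt_S`, `continuous_S`);
* Cauchy–Schwarz on this finite family (mass `≤ 1`) and the box bound of part 2 give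
  `dS(p)² ≤ Q_L(p)` (`dS_sq_le`) and `|S′(p)| ≤ g_L(p) := √(d χ^L_p / (p² (1 − p)))` (`abs_dS_le`);
* the `ℝ≥0∞` kernel `kernel d q = ofReal (√d / (q √(1 − q))) · χ_d(q)^{1/2}` dominates `ofReal (g_L q)`
  (`ofReal_gL_le_kernel`: `χ^L ≤ χ`), and the FTC on the polynomial `S` over `[p₁, p₂] ⊂ (0, 1)`
  passed to `∫⁻` gives `ofReal (S p₁ − S p₂) ≤ ∫⁻_{(p₁, p₂]} kernel` (`ofReal_S_sub_le_lintegral`).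

Continued in `NewmanTransfer.lean` (the identification lemma, continuity from below, Lemma 5 and
R_MID-12). Census evidence only (the D7 door's TRANSFER): nothing here bears on the hypothesis
`∫_0^{p_c} χ^{1/2} < ∞` for any `d`, nothing on `T(d)`, `3 ≤ d ≤ 10`.
-/

namespace Summit.Ventures.PercRepro0.Newman

open MeasureTheory ProbabilityTheory unitInterval Set Filter Topology
open Summit.Ventures.PercRepro0.Defs
open Summit.Ventures.PercRepro0.PcChi (chi)
open scoped ENNReal NNReal Classical

variable {d : ℕ}

/-! ### The truncated box sums `S_{L,N}` -/

/-- `S_{L,N}(p) = ∑_{F ∈ animals L, |vert F| ≤ N} w_F(p)`. -/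
noncomputable def S (d L N : ℕ) (p : ℝ) : ℝ :=
  ∑ F ∈ (animals d L).filter (fun F => (vertF d L F).card ≤ N), w d L F p

/-- `S_{L,N}(p) = P_p(|C_L(0)| ≤ N)` (Lemma 2 (b), box form). -/
theorem S_eq_P (L N : ℕ) (p : I) :
    S d L N p = (P d p {ω : Config d | (vertF d L (boxKF d L ω)).card ≤ N}).toReal :=
  sum_w_filter_eq L (fun F => (vertF d L F).card ≤ N) p

/-- `0 ≤ S_{L,N}(p)` on `[0, 1]`. -/
theorem S_nonneg (L N : ℕ) {p : ℝ} (h0 : 0 ≤ p) (h1 : p ≤ 1) : 0 ≤ S d L N p :=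
  Finset.sum_nonneg fun F _ => w_nonneg L F h0 h1

/-- `S_{L,N}(p) ≤ 1` on `[0, 1]`. -/
theorem S_le_one (L N : ℕ) {p : ℝ} (h0 : 0 ≤ p) (h1 : p ≤ 1) : S d L N p ≤ 1 := by
  rw [← sum_w_eq_one_real (d := d) L h0 h1]
  exact Finset.sum_le_sum_of_subset_of_nonneg (Finset.filter_subset _ _)
    fun F _ _ => w_nonneg L F h0 h1

/-- The derivative of `S_{L,N}` on `(0, 1)`. -/
noncomputable def dS (d L N : ℕ) (p : ℝ) : ℝ :=
  ∑ F ∈ (animals d L).filter (fun F => (vertF d L F).card ≤ N), D d L F p * w d L F p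

/-- `S_{L,N}′ = dS_{L,N}` on `(0, 1)`. -/
theorem hasDerivAt_S (L N : ℕ) {p : ℝ} (h0 : 0 < p) (h1 : p < 1) :
    HasDerivAt (S d L N) (dS d L N p) p := by
  have h := HasDerivAt.sum (u := (animals d L).filter (fun F => (vertF d L F).card ≤ N))
    fun F _ => hasDerivAt_w L F h0 h1
  refine h.congr_of_eventuallyEq (Filter.Eventually.of_forall fun q => ?_)
  exact (Finset.sum_apply q _ _).symm

/-- `w_F` is continuous. -/
theorem continuous_w (L : ℕ) (F : Finset (Sym2 (Vertex d))) : Continuous (w d L F) :=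
  (continuous_pow _).mul ((continuous_const.sub continuous_id).pow _)

/-- `S_{L,N}` is continuous (a polynomial). -/
theorem continuous_S (L N : ℕ) : Continuous (S d L N) :=
  continuous_finsetSum _ fun F _ => continuous_w L F

/-- `D_F` is continuous on `(0, 1)`. -/
theorem continuousOn_D (L : ℕ) (F : Finset (Sym2 (Vertex d))) :
    ContinuousOn (D d L F) (Set.Ioo 0 1) := by
  unfold D
  refine ContinuousOn.sub ?_ ?_
  · exact continuousOn_const.div continuousOn_id fun q hq => hq.1.ne'
  · exact continuousOn_const.div (continuousOn_const.sub continuousOn_id) fun q hq =>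
      ne_of_gt (show (0 : ℝ) < 1 - q by linarith [hq.2])

/-- `dS_{L,N}` is continuous on `(0, 1)`. -/
theorem continuousOn_dS (L N : ℕ) : ContinuousOn (dS d L N) (Set.Ioo 0 1) := by
  unfold dS
  refine continuousOn_finsetSum _ fun F _ => ?_
  exact (continuousOn_D L F).mul (continuous_w L F).continuousOn

/-! ### Cauchy–Schwarz: `|S′(p)| ≤ √(d χ^L_p / (p² (1 − p)))` -/

/-- The majorant `g_L(p) = √(d χ^L_p / (p² (1 − p)))`. -/
noncomputable def gL (d L : ℕ) (p : ℝ) : ℝ :=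
  Real.sqrt (d * ChiLower.chiBox d L p / (p ^ 2 * (1 - p)))

/-- `dS_{L,N}(p)² ≤ Q_L(p)` on `(0, 1)` (Cauchy–Schwarz on the finite family, mass `≤ 1`). -/
theorem dS_sq_le (L N : ℕ) {p : ℝ} (h0 : 0 < p) (h1 : p < 1) :
    dS d L N p ^ 2 ≤ ∑ F ∈ animals d L, D d L F p ^ 2 * w d L F p := by
  set T := (animals d L).filter (fun F => (vertF d L F).card ≤ N) with hT
  have hw : ∀ F, 0 ≤ w d L F p := fun F => w_nonneg L F h0.le h1.le
  have hcs := Finset.sum_mul_sq_le_sq_mul_sq T (fun F => D d L F p * Real.sqrt (w d L F p))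
    (fun F => Real.sqrt (w d L F p))
  have h1' : ∀ F, D d L F p * Real.sqrt (w d L F p) * Real.sqrt (w d L F p) = D d L F p * w d L F p := by
    intro F
    rw [mul_assoc, Real.mul_self_sqrt (hw F)]
  have h2' : ∀ F, (D d L F p * Real.sqrt (w d L F p)) ^ 2 = D d L F p ^ 2 * w d L F p := by
    intro F
    rw [mul_pow, Real.sq_sqrt (hw F)]
  have h3' : ∀ F, Real.sqrt (w d L F p) ^ 2 = w d L F p := fun F => Real.sq_sqrt (hw F)
  simp only [h1', h2', h3'] at hcs
  have hS : ∑ F ∈ T, w d L F p ≤ 1 := S_le_one L N h0.le h1.le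
  have hQ : ∑ F ∈ T, D d L F p ^ 2 * w d L F p ≤ ∑ F ∈ animals d L, D d L F p ^ 2 * w d L F p :=
    Finset.sum_le_sum_of_subset_of_nonneg (Finset.filter_subset _ _)
      fun F _ _ => mul_nonneg (sq_nonneg _) (hw F)
  have hQ0 : 0 ≤ ∑ F ∈ T, D d L F p ^ 2 * w d L F p :=
    Finset.sum_nonneg fun F _ => mul_nonneg (sq_nonneg _) (hw F)
  calc dS d L N p ^ 2 = (∑ F ∈ T, D d L F p * w d L F p) ^ 2 := rfl
    _ ≤ (∑ F ∈ T, D d L F p ^ 2 * w d L F p) * ∑ F ∈ T, w d L F p := hcs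
    _ ≤ (∑ F ∈ T, D d L F p ^ 2 * w d L F p) * 1 := by gcongr
    _ = ∑ F ∈ T, D d L F p ^ 2 * w d L F p := mul_one _
    _ ≤ _ := hQ

/-- `|dS_{L,N}(p)| ≤ g_L(p)` on `(0, 1)`. -/
theorem abs_dS_le (L N : ℕ) {p : ℝ} (h0 : 0 < p) (h1 : p < 1) : |dS d L N p| ≤ gL d L p := by
  unfold gL
  refine Real.abs_le_sqrt ?_
  refine (dS_sq_le L N h0 h1).trans ?_
  have := sum_D_sq_mul_w_le (d := d) L h0 h1
  rwa [ChiLower.toReal_chiBoxE] at this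

/-- `0 ≤ g_L`. -/
theorem gL_nonneg (L : ℕ) (p : ℝ) : 0 ≤ gL d L p := Real.sqrt_nonneg _

/-- `g_L` is continuous on `(0, 1)`. -/
theorem continuousOn_gL (L : ℕ) : ContinuousOn (gL d L) (Set.Ioo 0 1) := by
  unfold gL
  refine Real.continuous_sqrt.comp_continuousOn ?_
  refine ContinuousOn.div (continuousOn_const.mul (ChiLower.continuous_chiBox L).continuousOn) ?_ ?_
  · exact (continuousOn_pow 2).mul (continuousOn_const.sub continuousOn_id)
  · intro q hq
    have h1 : (0 : ℝ) < 1 - q := by linarith [hq.2]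
    have h2 : (0 : ℝ) < q ^ 2 := pow_pos hq.1 2
    exact ne_of_gt (mul_pos h2 h1)

/-! ### The FTC step on the polynomial `S` and the passage to `∫⁻` -/

/-- The `ℝ≥0∞`-valued kernel `ofReal (√d / (q √(1 − q))) · χ_q^{1/2}` of Lemma 5. -/
noncomputable def kernel (d : ℕ) (q : ℝ) : ℝ≥0∞ :=
  ENNReal.ofReal (Real.sqrt d / (q * Real.sqrt (1 - q))) * (chi d (clamp q)) ^ (1 / 2 : ℝ)

/-- `ofReal (g_L(q)) ≤ kernel q` on `(0, 1)`: `χ^L ≤ χ`. -/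
theorem ofReal_gL_le_kernel (L : ℕ) {q : ℝ} (h0 : 0 < q) (h1 : q < 1) :
    ENNReal.ofReal (gL d L q) ≤ kernel d q := by
  have h1' : (0 : ℝ) < 1 - q := by linarith
  have hχ : 0 ≤ ChiLower.chiBox d L q := by
    rw [← ChiLower.toReal_chiBoxE]; exact ENNReal.toReal_nonneg
  have hsplit : gL d L q = Real.sqrt d / (q * Real.sqrt (1 - q)) * Real.sqrt (ChiLower.chiBox d L q) := by
    unfold gL
    rw [show (d : ℝ) * ChiLower.chiBox d L q / (q ^ 2 * (1 - q)) =
        ((Real.sqrt d / (q * Real.sqrt (1 - q))) ^ 2) * ChiLower.chiBox d L q by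
      rw [div_pow, Real.sq_sqrt (Nat.cast_nonneg d), mul_pow, Real.sq_sqrt h1'.le]
      field_simp]
    rw [Real.sqrt_mul (sq_nonneg _), Real.sqrt_sq (by positivity)]
  rw [hsplit, ENNReal.ofReal_mul (by positivity)]
  unfold kernel
  gcongr
  rw [Real.sqrt_eq_rpow, ← ENNReal.ofReal_rpow_of_nonneg hχ (by norm_num), ← ChiLower.toReal_chiBoxE,
    ENNReal.ofReal_toReal (ChiLower.chiBoxE_ne_top L _)]
  exact ENNReal.rpow_le_rpow (ChiLower.chiBoxE_le_chi L _) (by norm_num)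

/-- The FTC on the polynomial `S_{L,N}` over `[p₁, p₂] ⊂ (0, 1)`, passed to `∫⁻`:
`ofReal (S p₁ − S p₂) ≤ ∫⁻_{(p₁, p₂]} kernel`. -/
theorem ofReal_S_sub_le_lintegral (L N : ℕ) {p₁ p₂ : ℝ} (h0 : 0 < p₁) (h12 : p₁ ≤ p₂) (h1 : p₂ < 1) :
    ENNReal.ofReal (S d L N p₁ - S d L N p₂) ≤ ∫⁻ q in Set.Ioc p₁ p₂, kernel d q := by
  have hIcc : Set.Icc p₁ p₂ ⊆ Set.Ioo 0 1 := fun q hq => ⟨lt_of_lt_of_le h0 hq.1, lt_of_le_of_lt hq.2 h1⟩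
  have hderiv : ∀ q ∈ Set.Ioo p₁ p₂, HasDerivAt (S d L N) (dS d L N q) q := fun q hq =>
    hasDerivAt_S L N (lt_trans h0 hq.1) (lt_trans hq.2 h1)
  have hint : IntervalIntegrable (dS d L N) volume p₁ p₂ :=
    ((continuousOn_dS L N).mono hIcc).intervalIntegrable_of_Icc h12
  have hftc : ∫ q in p₁..p₂, dS d L N q = S d L N p₂ - S d L N p₁ :=
    intervalIntegral.integral_eq_sub_of_hasDerivAt_of_le h12 (continuous_S L N).continuousOn hderiv hint
  have hgint : IntervalIntegrable (gL d L) volume p₁ p₂ :=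
    ((continuousOn_gL L).mono hIcc).intervalIntegrable_of_Icc h12
  have habs : IntervalIntegrable (fun q => |dS d L N q|) volume p₁ p₂ := hint.abs
  have hle : S d L N p₁ - S d L N p₂ ≤ ∫ q in p₁..p₂, gL d L q := by
    calc S d L N p₁ - S d L N p₂ = -∫ q in p₁..p₂, dS d L N q := by rw [hftc]; ring
      _ = ∫ q in p₁..p₂, -dS d L N q := (intervalIntegral.integral_neg).symm
      _ ≤ ∫ q in p₁..p₂, |dS d L N q| :=
          intervalIntegral.integral_mono_on h12 hint.neg habs fun q _ => neg_le_abs _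
      _ ≤ ∫ q in p₁..p₂, gL d L q :=
          intervalIntegral.integral_mono_on h12 habs hgint fun q hq =>
            abs_dS_le L N (hIcc hq).1 (hIcc hq).2
  calc ENNReal.ofReal (S d L N p₁ - S d L N p₂) ≤ ENNReal.ofReal (∫ q in p₁..p₂, gL d L q) :=
        ENNReal.ofReal_le_ofReal hle
    _ = ∫⁻ q in Set.Ioc p₁ p₂, ENNReal.ofReal (gL d L q) := by
        rw [intervalIntegral.integral_of_le h12,
          ofReal_integral_eq_lintegral_ofReal
            (((continuousOn_gL L).mono hIcc).integrableOn_Icc.mono_set Set.Ioc_subset_Icc_self)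
            (Filter.Eventually.of_forall (gL_nonneg L))]
    _ ≤ ∫⁻ q in Set.Ioc p₁ p₂, kernel d q := by
        refine lintegral_mono_ae ?_
        filter_upwards [ae_restrict_mem measurableSet_Ioc] with q hq
        exact ofReal_gL_le_kernel L (lt_of_lt_of_le h0 hq.1.le) (lt_of_le_of_lt hq.2 h1)

end Summit.Ventures.PercRepro0.Newman
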